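import Literature.Barriers.CriticalPhenomena.PlaquetteWalkHoleRootTightNearCells
import Literature.Barriers.CriticalPhenomena.PlaquetteWalkHoleRootRootNotchEastWall
import Literature.Barriers.CriticalPhenomena.PlaquetteWalkHoleRootNearCellsTight
import HarnessLib

/-!
# Barrier catalogue (SAWScalingLimit): LAW L AT DISTANCE ONE — THE CLASSIFICATION

Leaf of `PlaquetteWalkHoleRootTightNearCells` (hole two rows from the bottom / top wall: the cell below / above the hole or
the root plaquette empties its route), `PlaquetteWalkHoleRootRootNotchEastWall` (root plaquette's eastern neighbour in the
last column: a root notch empties its route; witnesses `notchBlockEO1`, `notchBlockEU2`), `PlaquetteWalkHoleRootNearCellsTight`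
(witnesses `tightBlockSU2/SU1/NO1/NO2` avoiding `holeS` / `holeN` inside the columns `[1,5]`) and the landed blocks of
`PlaquetteWalkHoleRootNearCells`, `…InteriorRing`, `…ThinBoxTable`. Setting: the `m × n` box `boxMinus m n [h, c]`, hole `h` at
distance `≥ 2` from every wall, root plaquette `(h.1 + 1, h.2)` rooted at `W`, far cell `(h.1 − 1, h.2)`, ONE near cell
`c ∈ {holeS, rootS, holeN, rootN} = {(h.1, h.2 ∓ 1), (h.1 + 1, h.2 ∓ 1)}` removed; `P₁ … P₄` the four universal kill
statements of LAW L.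

★★★★★ `lawL_box_near_kills_iff` — at every angle, `P₁ ∨ P₂ ∨ P₃ ∨ P₄` **IFF** the wall behind `c` is exactly two rows from
the hole (`c` below and `h.2 = 2`, or `c` above and `h.2 + 3 = n`) **OR** `c` is a root notch and the root plaquette's eastern
neighbour lies in the last column (`c.1 = h.1 + 1` and `h.1 + 3 = m`). In the three cases the cell's own route is EMPTY (two
kill statements hold vacuously); otherwise wound walks of all four kinds survive. Closed form `lawL_box_near_kills_iff'`.
With `lawL_box_kills_iff` (`PlaquetteWalkHoleRootLawLClassification`, Chebyshev distance `≥ 2`) and the far cell's doors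
`farSW`, `farNW` (`VF ≡ 0`, `PlaquetteWalkHoleRootThinBoxCells`) this completes the classification of single removals around
a hole at distance `≥ 2` from the walls.

Not in print; venture lane «pcv-sawmu», seat b-step0 gen 28.

References: A. Glazman, I. Manolescu, arXiv:1708.00395v3, §1 (Fig. 1, Fig. 2, remark after eq. (1)), §2.1, §4.2, Lemma 2.1
[GlazmanManolescu2019]; A. Glazman, Electron. Commun. Probab. 20 (2015) no. 86, Lemma 3.1, proof pp. 6–7
[Glazman2015WeightedSAW]; R. Courant, H. Robbins, *What is Mathematics?* (1941/1958), Ch. V Appendix §2 (the even–odd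
rule) [CourantRobbins1958].
-/

noncomputable section

open Set Function Complex

namespace Literature.Barriers.CriticalPhenomena.PlaquetteWalk

open Literature.Probability.RandomPlanarGeometry.SAW.YangBaxter
open Real Complex

section Classification

variable {m n : ℕ} {h : Face}

/-- ★★★★★ **LAW L AT DISTANCE ONE, THE CLASSIFICATION.** In the `m × n` box with the hole `h` at distance `≥ 2` from every wall,
remove the hole and ONE of `holeS = (h.1, h.2 − 1)`, `rootS = (h.1 + 1, h.2 − 1)`, `holeN = (h.1, h.2 + 1)`,
`rootN = (h.1 + 1, h.2 + 1)`. Then, at every angle `θ`, SOME universal kill statement of LAW L holds at the far cell of the root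
plaquette IF AND ONLY IF the removed cell lies below with the bottom wall two rows under the hole (`h.2 = 2`), or above with
the top wall two rows over it (`h.2 + 3 = n`), or it is a root notch (`x = h.1 + 1`) and the root plaquette's eastern neighbour
is in the last column (`h.1 + 3 = m`) — and then that cell's own route is EMPTY (`lawL_box_tightS_not_wound_under`,
`lawL_box_tightN_not_wound_over`, `lawL_box_eastRootE_rootS_not_wound_under`, `lawL_box_eastRootE_rootN_not_wound_over`);
in every other position wound walks of all four kinds survive (blocks `tightBlockSU2/SU1/NO1/NO2`, `notchBlockEO1/EU2`,
`nearBlockSU2/SU1/SO2/NU1`, `ringBlockUS2a/ON1a`, `thinBlockON1hr/ON2hr`).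
[cite: GlazmanManolescu2019, §1 (Fig. 2 and the remark after eq. (1)), §2.1, §4.2, Lemma 2.1]
[cite: Glazman2015WeightedSAW, Lemma 3.1 (proof, pp. 6–7)] [cite: CourantRobbins1958, Ch. V Appendix §2 (the even–odd rule)] -/
theorem lawL_box_near_kills_iff (hW : 2 ≤ h.1) (hE : h.1 + 3 ≤ m) (hS : 2 ≤ h.2) (hN : h.2 + 3 ≤ n) {x y : ℤ}
    (hnear : (x = h.1 ∨ x = h.1 + 1) ∧ (y = h.2 - 1 ∨ y = h.2 + 1))
    (hr : RootedFace (dom (boxMinus m n [h, (x, y)])) (Face.side (h.1 + 1, h.2) .W) (farW (h.1 + 1, h.2))) (θ : ℝ) :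
    ((∀ (ω : ΩG (dom (boxMinus m n [h, (x, y)])) (Face.side (h.1 + 1, h.2) .W) (farW (h.1 + 1, h.2))) (hb : ω.IsB2a),
        ω.2.firstSideG = .S → ω.WE (fun _ => θ) ≠ excursionWinding θ ω.2.firstSideG (ω.z1 hr hb) ω.1 →
          ¬ω.2.W2FreeOff (farW (h.1 + 1, h.2))) ∨
      (∀ (ω : ΩG (dom (boxMinus m n [h, (x, y)])) (Face.side (h.1 + 1, h.2) .W) (farW (h.1 + 1, h.2))) (hb : ω.IsB2a),
        ω.2.firstSideG = .N → ω.WE (fun _ => θ) ≠ excursionWinding θ ω.2.firstSideG (ω.z1 hr hb) ω.1 →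
          ¬ω.2.W1FreeOff (farW (h.1 + 1, h.2))) ∨
      (∀ (ω : ΩG (dom (boxMinus m n [h, (x, y)])) (Face.side (h.1 + 1, h.2) .W) (farW (h.1 + 1, h.2))) (hb : ω.IsB2a),
        ω.2.firstSideG = .S → ω.WE (fun _ => θ) ≠ excursionWinding θ ω.2.firstSideG (ω.z1 hr hb) ω.1 →
          ¬ω.2.W1FreeOff (farW (h.1 + 1, h.2))) ∨
      (∀ (ω : ΩG (dom (boxMinus m n [h, (x, y)])) (Face.side (h.1 + 1, h.2) .W) (farW (h.1 + 1, h.2))) (hb : ω.IsB2a),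
        ω.2.firstSideG = .N → ω.WE (fun _ => θ) ≠ excursionWinding θ ω.2.firstSideG (ω.z1 hr hb) ω.1 →
          ¬ω.2.W2FreeOff (farW (h.1 + 1, h.2)))) ↔
      ((y = h.2 - 1 ∧ h.2 = 2) ∨ (y = h.2 + 1 ∧ h.2 + 3 = n) ∨ (x = h.1 + 1 ∧ h.1 + 3 = m)) := by
  have hh : h ∈ [h, (x, y)] := by simp
  have hfS : ((h.1 - 1, h.2) : Face) ∉ [h, (x, y)] := by
    rw [List.mem_cons, List.mem_singleton, not_or]
    exact ⟨fun e => by have := (Prod.ext_iff.1 e).1; simp only at this; omega,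
      fun e => by have := (Prod.ext_iff.1 e).1; simp only at this; omega⟩
  obtain ⟨hx, hy⟩ := hnear
  constructor
  · -- (⇒) contrapositive: off the three tight positions all four kinds of wound walks survive
    intro hk
    by_contra hno
    have sub := block_hroot_subset_boxMinus_of_bounds (m := m) (n := n) (h := h)
    have hfour : (¬ ∀ (ω : ΩG (dom (boxMinus m n [h, (x, y)])) (Face.side (h.1 + 1, h.2) .W) (farW (h.1 + 1, h.2)))
          (hb : ω.IsB2a), ω.2.firstSideG = .S → ω.WE (fun _ => θ) ≠ excursionWinding θ ω.2.firstSideG (ω.z1 hr hb) ω.1 →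
            ¬ω.2.W2FreeOff (farW (h.1 + 1, h.2))) ∧
        (¬ ∀ (ω : ΩG (dom (boxMinus m n [h, (x, y)])) (Face.side (h.1 + 1, h.2) .W) (farW (h.1 + 1, h.2)))
          (hb : ω.IsB2a), ω.2.firstSideG = .N → ω.WE (fun _ => θ) ≠ excursionWinding θ ω.2.firstSideG (ω.z1 hr hb) ω.1 →
            ¬ω.2.W1FreeOff (farW (h.1 + 1, h.2))) ∧
        (¬ ∀ (ω : ΩG (dom (boxMinus m n [h, (x, y)])) (Face.side (h.1 + 1, h.2) .W) (farW (h.1 + 1, h.2)))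
          (hb : ω.IsB2a), ω.2.firstSideG = .S → ω.WE (fun _ => θ) ≠ excursionWinding θ ω.2.firstSideG (ω.z1 hr hb) ω.1 →
            ¬ω.2.W1FreeOff (farW (h.1 + 1, h.2))) ∧
        (¬ ∀ (ω : ΩG (dom (boxMinus m n [h, (x, y)])) (Face.side (h.1 + 1, h.2) .W) (farW (h.1 + 1, h.2)))
          (hb : ω.IsB2a), ω.2.firstSideG = .N → ω.WE (fun _ => θ) ≠ excursionWinding θ ω.2.firstSideG (ω.z1 hr hb) ω.1 →
            ¬ω.2.W2FreeOff (farW (h.1 + 1, h.2))) := by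
      rcases hy with rfl | rfl <;> rcases hx with rfl | rfl
      · -- holeS, three rows below
        have h3 : 3 ≤ h.2 := by omega
        exact not_killed_of_witnesses hr θ
          (exists_under_W2FreeOff_of_tightBlockSU2 (sub tightBlockSU242 1 5 (-1) 3 3 1 (by decide) (by omega) (by omega)
            (by omega) (by omega) ⟨by omega, by omega⟩) hr θ)
          (exists_over_W1FreeOff_of_notchBlockEO1 (sub notchBlockEO142 1 5 0 4 3 1 (by decide) (by omega) (by omega)
            (by omega) (by omega) ⟨by omega, by omega⟩) hr θ)
          (exists_under_W1FreeOff_of_tightBlockSU1 (sub tightBlockSU142 1 5 (-1) 3 3 1 (by decide) (by omega) (by omega)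
            (by omega) (by omega) ⟨by omega, by omega⟩) hr θ)
          (exists_over_W2FreeOff_of_nearBlockSO2 (sub nearBlockSO242 1 5 0 4 3 1 (by decide) (by omega) (by omega)
            (by omega) (by omega) ⟨by omega, by omega⟩) hr θ)
      · -- rootS, three rows below and a free column east of rootE
        have h3 : 3 ≤ h.2 := by omega
        have h4 : h.1 + 4 ≤ m := by omega
        exact not_killed_of_witnesses hr θ
          (exists_under_W2FreeOff_of_nearBlockSU2 (sub nearBlockSU242 1 6 (-1) 3 4 1 (by decide) (by omega) (by omega)
            (by omega) (by omega) ⟨by omega, by omega⟩) hr θ)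
          (exists_over_W1FreeOff_of_ringBlockON1a (sub ringBlockON1a42 1 6 0 4 4 1 (by decide) (by omega) (by omega)
            (by omega) (by omega) ⟨by omega, by omega⟩) hr θ)
          (exists_under_W1FreeOff_of_nearBlockSU1 (sub nearBlockSU142 1 6 (-1) 3 4 1 (by decide) (by omega) (by omega)
            (by omega) (by omega) ⟨by omega, by omega⟩) hr θ)
          (exists_over_W2FreeOff_of_nearBlockSO2 (sub nearBlockSO242 1 5 0 4 4 1 (by decide) (by omega) (by omega)
            (by omega) (by omega) ⟨by omega, by omega⟩) hr θ)
      · -- holeN, three rows above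
        have h3 : h.2 + 4 ≤ n := by omega
        exact not_killed_of_witnesses hr θ
          (exists_under_W2FreeOff_of_notchBlockEU2 (sub notchBlockEU242 1 5 0 4 3 3 (by decide) (by omega) (by omega)
            (by omega) (by omega) ⟨by omega, by omega⟩) hr θ)
          (exists_over_W1FreeOff_of_tightBlockNO1 (sub tightBlockNO142 1 5 1 5 3 3 (by decide) (by omega) (by omega)
            (by omega) (by omega) ⟨by omega, by omega⟩) hr θ)
          (exists_under_W1FreeOff_of_nearBlockNU1 (sub nearBlockNU142 1 5 0 4 3 3 (by decide) (by omega) (by omega)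
            (by omega) (by omega) ⟨by omega, by omega⟩) hr θ)
          (exists_over_W2FreeOff_of_tightBlockNO2 (sub tightBlockNO242 1 5 1 5 3 3 (by decide) (by omega) (by omega)
            (by omega) (by omega) ⟨by omega, by omega⟩) hr θ)
      · -- rootN, three rows above and a free column east of rootE
        have h3 : h.2 + 4 ≤ n := by omega
        have h4 : h.1 + 4 ≤ m := by omega
        exact not_killed_of_witnesses hr θ
          (exists_under_W2FreeOff_of_ringBlockUS2a (sub ringBlockUS2a42 1 6 0 4 4 3 (by decide) (by omega) (by omega)
            (by omega) (by omega) ⟨by omega, by omega⟩) hr θ)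
          (exists_over_W1FreeOff_of_thinBlockON1hr (sub thinBlockON1hr42 1 6 1 5 4 3 (by decide) (by omega) (by omega)
            (by omega) (by omega) ⟨by omega, by omega⟩) hr θ)
          (exists_under_W1FreeOff_of_nearBlockNU1 (sub nearBlockNU142 1 5 0 4 4 3 (by decide) (by omega) (by omega)
            (by omega) (by omega) ⟨by omega, by omega⟩) hr θ)
          (exists_over_W2FreeOff_of_thinBlockON2hr (sub thinBlockON2hr42 1 6 1 5 4 3 (by decide) (by omega) (by omega)
            (by omega) (by omega) ⟨by omega, by omega⟩) hr θ)
    obtain ⟨n1, n2, n3, n4⟩ := hfour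
    rcases hk with hk | hk | hk | hk
    · exact n1 hk
    · exact n2 hk
    · exact n3 hk
    · exact n4 hk
  · -- (⇐) each tight position empties the cell's own route
    rintro (⟨rfl, h2⟩ | ⟨rfl, h3⟩ | ⟨rfl, h3⟩)
    · refine Or.inl fun ω hb hS' hW' => absurd ?_ hW'
      exact lawL_box_tightS_not_wound_under (S := [h, (x, h.2 - 1)]) (by omega) (by omega) h2 (by omega) hh hfS
        (by rcases hx with rfl | rfl
            · left
              have e : ((h.1, 1) : Face) = (h.1, h.2 - 1) := Prod.ext rfl (by simp only; omega)
              rw [e]; simp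
            · right
              have e : ((h.1 + 1, 1) : Face) = (h.1 + 1, h.2 - 1) := Prod.ext rfl (by simp only; omega)
              rw [e]; simp) ω hb hS' θ
    · refine Or.inr (Or.inl fun ω hb hN' hW' => absurd ?_ hW')
      exact lawL_box_tightN_not_wound_over (S := [h, (x, h.2 + 1)]) (by omega) (by omega) (by omega) h3 hh hfS
        (by rcases hx with rfl | rfl
            · left; simp
            · right; simp) ω hb hN' θ
    · rcases hy with rfl | rfl
      · refine Or.inl fun ω hb hS' hW' => absurd ?_ hW'
        exact lawL_box_eastRootE_rootS_not_wound_under (S := [h, (h.1 + 1, h.2 - 1)]) (by omega) h3 (by omega) (by omega)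
          hh hfS (by simp) ω hb hS' θ
      · refine Or.inr (Or.inl fun ω hb hN' hW' => absurd ?_ hW')
        exact lawL_box_eastRootE_rootN_not_wound_over (S := [h, (h.1 + 1, h.2 + 1)]) (by omega) h3 (by omega) (by omega)
          hh hfS (by simp) ω hb hN' θ

/-- ★★★★★ **LAW L AT DISTANCE ONE, THE CLASSIFICATION — closed form** (the rooting hypothesis discharged by
`rootedFace_hroot_boxMinus_cell`). [cite: GlazmanManolescu2019, §1 (Fig. 2 and the remark after eq. (1)), §2.1, §4.2, Lemma 2.1]
[cite: Glazman2015WeightedSAW, Lemma 3.1 (proof, pp. 6–7)] [cite: CourantRobbins1958, Ch. V Appendix §2 (the even–odd rule)] -/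
theorem lawL_box_near_kills_iff' (hW : 2 ≤ h.1) (hE : h.1 + 3 ≤ m) (hS : 2 ≤ h.2) (hN : h.2 + 3 ≤ n) {x y : ℤ}
    (hnear : (x = h.1 ∨ x = h.1 + 1) ∧ (y = h.2 - 1 ∨ y = h.2 + 1)) (θ : ℝ) :
    let hr : RootedFace (dom (boxMinus m n [h, (x, y)])) (Face.side (h.1 + 1, h.2) .W) (farW (h.1 + 1, h.2)) :=
      rootedFace_hroot_boxMinus_cell (by omega) (by omega) (by omega) (by omega) (by omega)
    ((∀ (ω : ΩG (dom (boxMinus m n [h, (x, y)])) (Face.side (h.1 + 1, h.2) .W) (farW (h.1 + 1, h.2))) (hb : ω.IsB2a),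
        ω.2.firstSideG = .S → ω.WE (fun _ => θ) ≠ excursionWinding θ ω.2.firstSideG (ω.z1 hr hb) ω.1 →
          ¬ω.2.W2FreeOff (farW (h.1 + 1, h.2))) ∨
      (∀ (ω : ΩG (dom (boxMinus m n [h, (x, y)])) (Face.side (h.1 + 1, h.2) .W) (farW (h.1 + 1, h.2))) (hb : ω.IsB2a),
        ω.2.firstSideG = .N → ω.WE (fun _ => θ) ≠ excursionWinding θ ω.2.firstSideG (ω.z1 hr hb) ω.1 →
          ¬ω.2.W1FreeOff (farW (h.1 + 1, h.2))) ∨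
      (∀ (ω : ΩG (dom (boxMinus m n [h, (x, y)])) (Face.side (h.1 + 1, h.2) .W) (farW (h.1 + 1, h.2))) (hb : ω.IsB2a),
        ω.2.firstSideG = .S → ω.WE (fun _ => θ) ≠ excursionWinding θ ω.2.firstSideG (ω.z1 hr hb) ω.1 →
          ¬ω.2.W1FreeOff (farW (h.1 + 1, h.2))) ∨
      (∀ (ω : ΩG (dom (boxMinus m n [h, (x, y)])) (Face.side (h.1 + 1, h.2) .W) (farW (h.1 + 1, h.2))) (hb : ω.IsB2a),
        ω.2.firstSideG = .N → ω.WE (fun _ => θ) ≠ excursionWinding θ ω.2.firstSideG (ω.z1 hr hb) ω.1 →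
          ¬ω.2.W2FreeOff (farW (h.1 + 1, h.2)))) ↔
      ((y = h.2 - 1 ∧ h.2 = 2) ∨ (y = h.2 + 1 ∧ h.2 + 3 = n) ∨ (x = h.1 + 1 ∧ h.1 + 3 = m)) :=
  lawL_box_near_kills_iff hW hE hS hN hnear _ θ

end Classification

end Literature.Barriers.CriticalPhenomena.PlaquetteWalk
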